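import Summits.BirchSwinnertonDyer.BirchSwinnertonDyer.Theorems.ByReductionTypeAtTwoRankOneAtTwoBigImageOddLocalOneDoorSubsliceResidueShaTransportNeg
import HarnessLib

/-!
# Route ByReductionTypeAtTwo, crux `RankOneAtTwoBigImageOddLocal` (stmt-BirchSwinnertonDyer-23715): -desc's BSD₂ candidates DESC-27-T / DESC-27-TT
# («visible factor 4 of `L(W^{(d)},1)`») are NOT independent conjectures on non-CM curves — they follow from the route's four RANK-`0` cruxes at `2`
# BY NAME plus the proved transport

Width prover seat `bsd-line-fkl-p2` g14 (2026-08-28), `--supports stmt-BirchSwinnertonDyer-23715` (helper).  THEOREMS ONLY; BSD is not proved by any of this.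
-desc g19's `ResidueDoorVisibleFourAtTwo` (T, `F1Sign2/DoorVisibilityAtTwo.lean`) and `ResidueNegDoorVisibleFourAtTwo` (TT, `…DoorVisibilityAtTwoNegDisc.lean`):
on the residue {rank `1`, `E(ℚ)[2] = 0`, `#Ш(W)[2] = 4` (+ `Δ_W > 0`, egg / + `Δ_W < 0`)}, at a desc-admissible / met transposition door whose twist has
`L(W^{(d)}, 1) ≠ 0`, `#Ш_an(Wd) ∈ ℚ` with `v₂ ≥ 2` for a globally minimal model `Wd`.  REF1 §146/§149 graded them «conjecture-grade = BSD₂ of the rank-0 twin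
down to 2²».  Here, for NON-CM `W`: the twin `Wd` is non-CM (`j`-invariance) and of analytic rank `0` (`L ≠ 0`, modularity), so the route's four rank-`0` cruxes
(`GoodOrdinaryRankZeroAtTwo`, `MultiplicativeRankZeroAtTwo`, `SupersingularRankZeroAtTwo`, `AdditiveRankZeroAtTwo`, BY NAME through `bsdp_two_of_rankZero_cruxes`)
give `BSDp Wd 2`: `rank Wd(ℚ) = 0`, `Ш(Wd)[2^∞]` finite, `#Ш_an(Wd) = q ∈ ℚ` with `v₂(q) = ord₂ #Ш(Wd)[2^∞]`; and the PROVED transport (rows X / XT,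
`two_le_sd_of_residue` / `two_le_sd_of_residueNeg`) gives `ord₂ #Ш(Wd)[2^∞] ≥ 2`.  No Gross–Zagier / Kolyvagin is needed (the residue carries `rank E(ℚ) = 1`
as a hypothesis and the twin's rank comes from `BSDp Wd 2`).

* `residueDoorVisibleFour_nonCM_of_rankZero_cruxes` (T on non-CM curves ⟸ modularity + the four rank-`0` cruxes);
* `residueNegDoorVisibleFour_nonCM_of_rankZero_cruxes` (TT likewise).

References: [Kramer1981] Prop. 3, §2 Prop. 6, Thm. 1; [MazurRubin2010] Prop. 3.3, Cor. 3.4 (i); [Miller2011LMS] Def. 1.1; [SilvermanAEC2009] X.§4.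
-/

set_option autoImplicit false
-- the Theorems namespace of this sub repeats the summit name by design (D-0017 nested layout)
set_option linter.dupNamespace false

noncomputable section

open scoped Classical

namespace Summit.BirchSwinnertonDyer.BirchSwinnertonDyer.Theorems.RankOneAtTwoOneDoor

open WeierstrassCurve NumberField Literature.NumberTheory.EllipticCurves Literature.NumberTheory.EllipticCurves.ModularForms
  Summit.BirchSwinnertonDyer.Rank1Residual.F1Sign2
  Summit.BirchSwinnertonDyer.Rank1Residual.F1Sign2.TranspositionDoor
  Summit.BirchSwinnertonDyer.BirchSwinnertonDyer.Theses.ByReductionTypeAtTwo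
open Summit.BirchSwinnertonDyer.Rank1Residual.F1Sign2.TranspDoorVisibility (OnResidueNegAtTwo)

/-- **DESC-27-T ON NON-CM CURVES FROM THE ROUTE'S RANK-`0` CRUXES.**  `W/ℚ` globally minimal, NON-CM, on the egg residue `OnResidueAtTwo W` (`Δ_W > 0`,
`E(ℚ)[2] = 0`, rank `1`, `#Ш(W)[2] = 4`, `MeetsEgg`); `d` desc-admissible with `L(W^{(d)},1) ≠ 0`; `Wd` a globally minimal model of the twist.  THEN
`#Ш_an(Wd) = q ∈ ℚ` with `2 ≤ v₂(q)` — modulo modularity (`exists_isNewformOf`, for the analytic rank of the twin) and the four rank-`0` cruxes BY NAME: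
`BSDp Wd 2` supplies `q` with `v₂(q) = ord₂ #Ш(Wd)[2^∞]` and `rank Wd(ℚ) = 0`, the transport row X supplies `ord₂ #Ш(Wd)[2^∞] ≥ 2`.  CONDITIONAL by design;
nothing is asserted about the cruxes. [cite: Kramer1981, §2 Prop. 6 and Thm. 1] [cite: Miller2011LMS, Def. 1.1] [cite: SilvermanAEC2009, X.§4] -/
theorem residueDoorVisibleFour_nonCM_of_rankZero_cruxes (hnf : exists_isNewformOf)
    (hZ4 : GoodOrdinaryRankZeroAtTwo ∧ MultiplicativeRankZeroAtTwo ∧ SupersingularRankZeroAtTwo ∧ AdditiveRankZeroAtTwo)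
    (W : WeierstrassCurve ℚ) [W.IsElliptic] [W.IsGloballyMinimal] (hCM : ¬ W.HasCM) (hres : OnResidueAtTwo W)
    {d : ℤ} (hd : DescAdmissible W d) (hLt : (W.quadraticTwist (d : ℚ)).entireLFunction 1 ≠ 0)
    (Wd : WeierstrassCurve ℚ) [Wd.IsElliptic] [Wd.IsGloballyMinimal] (Cd : VariableChange ℚ) (hWd : Cd • W.quadraticTwist (d : ℚ) = Wd) :
    ∃ q : ℚ, shaAn Wd = (q : ℂ) ∧ 2 ≤ padicValRat 2 q := by
  have hmod : hasEntireLFunction_rat := hasEntireLFunction_rat_of_exists_isNewformOf hnf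
  have hd0 : (d : ℚ) ≠ 0 := by exact_mod_cast (ne_of_lt hd.1)
  haveI hEt : (W.quadraticTwist (d : ℚ)).IsElliptic := W.isElliptic_quadraticTwist hd0
  -- the twin: non-CM, analytic rank `0`, hence `BSDp Wd 2` from the rank-`0` cruxes
  have hCMd : ¬ Wd.HasCM := RamifiedPairUpperBound.not_hasCM_of_smul_quadraticTwist_eq hd0 hWd hCM
  have hLeq : Wd.entireLFunction = (W.quadraticTwist (d : ℚ)).entireLFunction := by rw [← hWd, entireLFunction_smul]
  have hrd : Wd.analyticRank = 0 := (Wd.analyticRank_eq_zero_iff_holds (hmod Wd)).2 (by rw [hLeq]; exact hLt)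
  obtain ⟨hrk, hfin, q, hq, hv⟩ := bsdp_two_of_rankZero_cruxes hZ4 Wd hCMd hrd
  haveI := hfin
  -- `rank W^{(d)}(ℚ) = 0` and the transport: `ord₂ #Ш(Wd)[2^∞] ≥ 2`
  have hr0 : (W.quadraticTwist (d : ℚ)).mordellWeilRank = 0 := by
    rw [← mordellWeilRank_variableChange_holds (W.quadraticTwist (d : ℚ)) Cd, hWd, hrk, hrd]
  have hsd := two_le_sd_of_residue W hres hd hr0 Wd Cd hWd
  refine ⟨q, hq, ?_⟩
  rw [hv]
  exact_mod_cast hsd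

/-- **DESC-27-TT ON NON-CM CURVES FROM THE ROUTE'S RANK-`0` CRUXES** (the `Δ_W < 0` residue at a met transposition door; transport row XT).  Same mechanism.
CONDITIONAL by design; nothing is asserted about the cruxes. [cite: Kramer1981, Prop. 3 and Thm. 1] [cite: MazurRubin2010, Prop. 3.3] [cite: Miller2011LMS, Def. 1.1] -/
theorem residueNegDoorVisibleFour_nonCM_of_rankZero_cruxes (hnf : exists_isNewformOf)
    (hZ4 : GoodOrdinaryRankZeroAtTwo ∧ MultiplicativeRankZeroAtTwo ∧ SupersingularRankZeroAtTwo ∧ AdditiveRankZeroAtTwo)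
    (W : WeierstrassCurve ℚ) [W.IsElliptic] [W.IsGloballyMinimal] [W.IsIntegral ℤ] (hCM : ¬ W.HasCM) (hres : OnResidueNegAtTwo W)
    {d : ℤ} {q₀ : ℕ} [Fact q₀.Prime] (htr : TranspAdmissible W d q₀) (hmeets : MeetsNonNormAt W q₀)
    (hLt : (W.quadraticTwist (d : ℚ)).entireLFunction 1 ≠ 0)
    (Wd : WeierstrassCurve ℚ) [Wd.IsElliptic] [Wd.IsGloballyMinimal] (Cd : VariableChange ℚ) (hWd : Cd • W.quadraticTwist (d : ℚ) = Wd) :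
    ∃ q : ℚ, shaAn Wd = (q : ℂ) ∧ 2 ≤ padicValRat 2 q := by
  have hmod : hasEntireLFunction_rat := hasEntireLFunction_rat_of_exists_isNewformOf hnf
  have hd0 : (d : ℚ) ≠ 0 := by exact_mod_cast (ne_of_lt htr.1)
  haveI hEt : (W.quadraticTwist (d : ℚ)).IsElliptic := W.isElliptic_quadraticTwist hd0
  have hCMd : ¬ Wd.HasCM := RamifiedPairUpperBound.not_hasCM_of_smul_quadraticTwist_eq hd0 hWd hCM
  have hLeq : Wd.entireLFunction = (W.quadraticTwist (d : ℚ)).entireLFunction := by rw [← hWd, entireLFunction_smul]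
  have hrd : Wd.analyticRank = 0 := (Wd.analyticRank_eq_zero_iff_holds (hmod Wd)).2 (by rw [hLeq]; exact hLt)
  obtain ⟨hrk, hfin, q, hq, hv⟩ := bsdp_two_of_rankZero_cruxes hZ4 Wd hCMd hrd
  haveI := hfin
  have hr0 : (W.quadraticTwist (d : ℚ)).mordellWeilRank = 0 := by
    rw [← mordellWeilRank_variableChange_holds (W.quadraticTwist (d : ℚ)) Cd, hWd, hrk, hrd]
  have hsd := two_le_sd_of_residueNeg W hres htr hmeets hr0 Wd Cd hWd
  refine ⟨q, hq, ?_⟩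
  rw [hv]
  exact_mod_cast hsd

end Summit.BirchSwinnertonDyer.BirchSwinnertonDyer.Theorems.RankOneAtTwoOneDoor

end
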